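import Summits.BirchSwinnertonDyer.BirchSwinnertonDyer.Theorems.Rank2Observatory2DescClRealCurveCertSN
import Summits.BirchSwinnertonDyer.BirchSwinnertonDyer.Theorems.ShaPrimaryTransferFiniteShaComponentTransferSelmerCubicRSXRow
import Summits.BirchSwinnertonDyer.BirchSwinnertonDyer.Theorems.ShaPrimaryTransferFiniteShaComponentTransferSelmerCubicNodalSel
import HarnessLib

/-!
# BirchSwinnertonDyer — the SEL2CUBIC door for the NODAL rows `checkRSN r`: certificate ⟹ `t₂(E) = 0`, `Ш(E/ℚ)[2^∞] = 0`, `rank = r`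

HONEST FRAMING: route `ShaPrimaryTransfer`, seat `bsd-line-spt-p1` (g32), `--supports` item T =
`FiniteShaComponentTransfer` (stmt-22356), UNCHANGED (conjecture-grade at corank ≥ 2). BSD in rank ≥ 2 is NOT
proved by any of this. THEOREMS ONLY.

Selmer reading of the census nodal consumer `TwoDescCl.rank_le_of_checkRSN` (`Rank2Observatory2DescClRealCurveCertSN`) = the host door
`sha_door_of_checkRSX` with its nodal conjunct discharged on `2`-SELMER classes by
`…SelmerCubicNodalSel.uvecOdd_mem_splitImgOdd_sel` / `uvecTwo_mem_splitImgTwo_sel` (local point carrying the class,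
representative with `y ≠ 0` from a rational point of infinite order — whence `1 ≤ r` —, per-place squares glued in `ℚ_ℓ ⊗ K`).
**`sha_door_of_checkRSN`**; `K`-free wrappers **`sha_door_of_certsRSN`**, **`shaCorank_two_eq_zero_of_certsRSN_scaled`**,
**`…_complSq`**, **`sha_door_of_certsRSN_plain`** in the census rows' argument shapes plus `hr : 1 ≤ r`. Generated by
`gen/selmerize_n.py` (the census proof verbatim up to these changes).
[cite: Cassels1991LecturesEllipticCurves, §15] [cite: SilvermanAEC2009, Thm. X.4.2, Rem. X.4.1] [cite: CremonaAlgorithms1997, §3.6]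
-/

-- single-conjunct summit: `Summit.BirchSwinnertonDyer.BirchSwinnertonDyer.…` repeats the name by design
set_option linter.dupNamespace false

noncomputable section

open scoped Classical NumberField nonZeroDivisors

open Literature.NumberTheory.NumberFields Literature.NumberTheory.EllipticCurves
  Literature.NumberTheory.GaloisRepresentations Polynomial Module NumberField IsDedekindDomain Ideal
open WeierstrassCurve WeierstrassCurve.Affine

namespace Summit.BirchSwinnertonDyer.BirchSwinnertonDyer.Theorems.ShaPrimaryTransferSelmerCubicCover

open Summit.BirchSwinnertonDyer.BirchSwinnertonDyer.Rank2Observatory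
open Summit.BirchSwinnertonDyer.BirchSwinnertonDyer.Rank2Observatory.TwoDescCubic
open Summit.BirchSwinnertonDyer.BirchSwinnertonDyer.Rank2Observatory.TwoDescCl
open Summit.BirchSwinnertonDyer.BirchSwinnertonDyer.Rank2Observatory.TwoDescCl.ClFieldCert
open Summit.BirchSwinnertonDyer.BirchSwinnertonDyer.Rank2Observatory.TwoDescCl.SplitImage
open Summit.BirchSwinnertonDyer.BirchSwinnertonDyer.Rank2Observatory.TwoDescPadic
open Summit.BirchSwinnertonDyer.BirchSwinnertonDyer.Theorems.ShaPrimaryTransferSelmerCubicNodal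

/-! ## The row door -/

section Row

variable {K : Type} [Field K] [NumberField K] {θ : K}

/-- **The SEL2CUBIC door for a `checkRSN r` row: `t₂(E) = 0`, `Ш(E/ℚ)[2^∞] = 0`, `rank E(ℚ) = r`** (`1 ≤ r ≤ rank`).
[cite: Cassels1991LecturesEllipticCurves, §15] [cite: SilvermanAEC2009, Thm. X.4.2, Rem. X.4.1] [cite: CremonaAlgorithms1997, §3.6] -/
theorem sha_door_of_checkRSN (r : ℕ) (G : ClFieldCertRS2)
    (hθ : aeval θ (MonicCubic.poly G.toS2.fs.base.a G.toS2.fs.base.b G.toS2.fs.base.c) = 0)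
    (h3 : finrank ℚ K = 3) (h2 : G.check2RS = true) (hpr : G.toS2.fs.base.primeList.Forall Nat.Prime)
    (c : ClCurveCertSRN) (hnp : (c.nod.map NodalCert.ℓ).Forall Nat.Prime) (hc : checkRSN G c r = true)
    (hr : 1 ≤ r) (hlow : r ≤ ((⟨0, c.cr.cc.A, 0, c.cr.cc.B, c.cr.cc.C⟩ : WeierstrassCurve ℚ)).mordellWeilRank) :
    ((⟨0, c.cr.cc.A, 0, c.cr.cc.B, c.cr.cc.C⟩ : WeierstrassCurve ℚ)).shaCorank 2 = 0 ∧
      AddCommGroup.primaryComponent ((⟨0, c.cr.cc.A, 0, c.cr.cc.B, c.cr.cc.C⟩ : WeierstrassCurve ℚ)).sha 2 = ⊥ ∧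
        ((⟨0, c.cr.cc.A, 0, c.cr.cc.B, c.cr.cc.C⟩ : WeierstrassCurve ℚ)).mordellWeilRank = r := by
  classical
  unfold checkRSN at hc
  have hcount := of_decide_eq_true (Bool.and_eq_true_iff.mp hc).2
  have h123 := (Bool.and_eq_true_iff.mp hc).1
  have hnod2 := List.all_eq_true.mp (Bool.and_eq_true_iff.mp h123).2
  have hnod := List.all_eq_true.mp (Bool.and_eq_true_iff.mp (Bool.and_eq_true_iff.mp h123).1).2
  have hcore := (Bool.and_eq_true_iff.mp (Bool.and_eq_true_iff.mp h123).1).1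
  have hK := G.const_of_check2RS h2
  have hS := G.coreS_of_check2RS h2
  have hR := G.toS2.fs.checkReg_of_coreS hS
  have hirr := G.toS2.fs.base.irreducible_of_reg hR
  have hm : (G.toS2.r₁ : ℤ) ≠ 0 := Nat.cast_ne_zero.mpr (G.toS2.r₁_pos hK).ne'
  have hmcast : (((G.toS2.r₁ : ℤ) ^ 2 : ℤ) : 𝓞 K) = (G.toS2.m₁ : 𝓞 K) := by
    simp only [ClFieldCertS2.m₁, Nat.cast_pow, Int.cast_pow, Int.cast_natCast]
  have hrank : 1 ≤ ((⟨0, c.cr.cc.A, 0, c.cr.cc.B, c.cr.cc.C⟩ : WeierstrassCurve ℚ)).mordellWeilRank := hr.trans hlow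
  have hΔ : deltaShort c.cr.cc.A c.cr.cc.B c.cr.cc.C ≠ 0 := by
    have h := hcore
    simp only [checkRSCore, Bool.and_eq_true, decide_eq_true_eq] at h
    exact h.1.1.1.1.1.1.1.1.1.1.1.1.1.1.1.1.1
  haveI hEl := isElliptic_of_deltaShort_ne hΔ
  haveI hEK : (((⟨0, c.cr.cc.A, 0, c.cr.cc.B, c.cr.cc.C⟩ : WeierstrassCurve ℚ)).baseChange K).IsElliptic := ((⟨0, c.cr.cc.A, 0, c.cr.cc.B, c.cr.cc.C⟩ : WeierstrassCurve ℚ)).isElliptic_baseChange K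
  refine sha_door_of_checkRSX r G hθ h3 h2 hpr c.cr hcore (extraNRS c) ?_ hcount hlow
  intro e W he hW hW0 hroot haev cS hcS aK haK U hsq
  have he' : (((G.toS2.r₁ : ℤ) ^ 2 : ℤ) : 𝓞 K) * e = lin hθ c.cr.cc.Xt.1 c.cr.cc.Xt.2.1 c.cr.cc.Xt.2.2 := by
    rw [hmcast]; exact he
  have hW' : ∀ j, (((G.toS2.r₁ : ℤ) ^ 2 : ℤ) : 𝓞 K) * W j = lin hθ ((famS c.cr.cc).get j).X.1
      ((famS c.cr.cc).get j).X.2.1 ((famS c.cr.cc).get j).X.2.2 := fun j => by rw [hmcast]; exact hW j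
  simp only [extraNRS, Bool.and_eq_true, List.all_eq_true, decide_eq_true_eq]
  refine ⟨fun n hn => ?_, fun n hn => ?_⟩
  · -- an odd nodal prime
    have hcl := hnod n hn
    simp only [nodalClauseOddRS, henselAll, Bool.and_eq_true, Bool.not_eq_true', decide_eq_false_iff_not,
      decide_eq_true_eq] at hcl
    obtain ⟨⟨⟨⟨hℓ2, ⟨hh0, hh1⟩, hh2⟩, hdist⟩, hdepth⟩, hprec⟩ := hcl
    have hp : n.ℓ.Prime := List.forall_iff_forall_mem.mp hnp n.ℓ (List.mem_map.mpr ⟨n, hn, rfl⟩)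
    haveI : Fact n.ℓ.Prime := ⟨hp⟩
    obtain ⟨R0⟩ := nonempty_rootedPrime_of_henselCheck (θ := θ) hirr hθ h3 hh0
    obtain ⟨R1⟩ := nonempty_rootedPrime_of_henselCheck (θ := θ) hirr hθ h3 hh1
    obtain ⟨R2⟩ := nonempty_rootedPrime_of_henselCheck (θ := θ) hirr hθ h3 hh2
    have hφ : ∀ i : Fin 3, (![R0.φ, R1.φ, R2.φ] : Fin 3 → (K →+* ℚ_[n.ℓ])) i θ =
        ((![R0.z, R1.z, R2.z] : Fin 3 → ℤ_[n.ℓ]) i : ℚ_[n.ℓ]) := by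
      intro i; fin_cases i
      exacts [R0.φ_theta, R1.φ_theta, R2.φ_theta]
    have hclose : ∀ i : Fin 3, ‖(![R0.z, R1.z, R2.z] : Fin 3 → ℤ_[n.ℓ]) i - (n.ar i : ℤ_[n.ℓ])‖ ≤
        (n.ℓ : ℝ) ^ (-(n.N : ℤ)) := by
      intro i; fin_cases i
      exacts [R0.close, R1.close, R2.close]
    exact uvecOdd_mem_splitImgOdd_sel (SqClassOdd.sqClassMapOdd n.ℓ) hℓ2 hθ ((⟨0, c.cr.cc.A, 0, c.cr.cc.B, c.cr.cc.C⟩ : WeierstrassCurve ℚ)) rfl rfl rfl rfl rfl hrank hm he'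
      hroot haev hcS aK haK hW' hW0 hsq hφ hclose hdist hdepth hprec
  · -- a `2`-adic nodal certificate
    have hcl := hnod2 n hn
    simp only [nodalClauseTwoRS, henselAll, Bool.and_eq_true, decide_eq_true_eq] at hcl
    obtain ⟨⟨⟨⟨hℓ, ⟨hh0, hh1⟩, hh2⟩, hdist⟩, hdepth⟩, hprec⟩ := hcl
    rw [hℓ] at hh0 hh1 hh2
    obtain ⟨R0⟩ := nonempty_rootedPrime_of_henselCheck (θ := θ) hirr hθ h3 hh0
    obtain ⟨R1⟩ := nonempty_rootedPrime_of_henselCheck (θ := θ) hirr hθ h3 hh1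
    obtain ⟨R2⟩ := nonempty_rootedPrime_of_henselCheck (θ := θ) hirr hθ h3 hh2
    have hφ : ∀ i : Fin 3, (![R0.φ, R1.φ, R2.φ] : Fin 3 → (K →+* ℚ_[2])) i θ =
        ((![R0.z, R1.z, R2.z] : Fin 3 → ℤ_[2]) i : ℚ_[2]) := by
      intro i; fin_cases i
      exacts [R0.φ_theta, R1.φ_theta, R2.φ_theta]
    have hclose : ∀ i : Fin 3, ‖(![R0.z, R1.z, R2.z] : Fin 3 → ℤ_[2]) i - (n.ar i : ℤ_[2])‖ ≤
        ((2 : ℕ) : ℝ) ^ (-(n.N : ℤ)) := by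
      intro i; fin_cases i
      exacts [R0.close, R1.close, R2.close]
    exact uvecTwo_mem_splitImgTwo_sel SqClassTwo.sqClassMapTwo hθ ((⟨0, c.cr.cc.A, 0, c.cr.cc.B, c.cr.cc.C⟩ : WeierstrassCurve ℚ)) rfl rfl rfl rfl rfl hrank hm he'
      hroot haev hcS aK haK hW' hW0 hsq hφ hclose hdist hdepth hprec

end Row

/-! ## `K`-free wrappers (the census rows' shapes, plus `hr : 1 ≤ r`) -/

section Rows

/-- `Δ ≠ 0` is the first clause of the core checker inside `checkRSN`. [folklore] -/
theorem deltaShort_ne_of_checkRSN {r : ℕ} {G : ClFieldCertRS2} {c : ClCurveCertSRN} (hc : checkRSN G c r = true) :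
    deltaShort c.cr.cc.A c.cr.cc.B c.cr.cc.C ≠ 0 := by
  unfold checkRSN at hc
  have hcore := (Bool.and_eq_true_iff.mp (Bool.and_eq_true_iff.mp (Bool.and_eq_true_iff.mp hc).1).1).1
  simp only [checkRSCore, Bool.and_eq_true, decide_eq_true_eq] at hcore
  exact hcore.1.1.1.1.1.1.1.1.1.1.1.1.1.1.1.1.1

/-- **`K`-free door shape** (model `(0, A, 0, B, C)` read over `ℚ` from `ℤ`), in the shape of `rank_eq_of_certsRSN` plus
`hr : 1 ≤ r`. [cite: Cassels1991LecturesEllipticCurves, §15] [cite: CremonaAlgorithms1997, §3.6] -/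
theorem sha_door_of_certsRSN (r : ℕ) (G : ClFieldCertRS2) (c : ClCurveCertSRN) (h2 : G.check2RS = true)
    (hpr : G.toS2.fs.base.primeList.Forall Nat.Prime) (hnp : (c.nod.map NodalCert.ℓ).Forall Nat.Prime)
    (hc : checkRSN G c r = true) (hr : 1 ≤ r)
    (hlow : r ≤ (((⟨0, c.cr.cc.A, 0, c.cr.cc.B, c.cr.cc.C⟩ : WeierstrassCurve ℤ)).map (Int.castRingHom ℚ)).mordellWeilRank) :
    (((⟨0, c.cr.cc.A, 0, c.cr.cc.B, c.cr.cc.C⟩ : WeierstrassCurve ℤ)).map (Int.castRingHom ℚ)).shaCorank 2 = 0 ∧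
      AddCommGroup.primaryComponent (((⟨0, c.cr.cc.A, 0, c.cr.cc.B, c.cr.cc.C⟩ : WeierstrassCurve ℤ)).map (Int.castRingHom ℚ)).sha 2 = ⊥ ∧
        (((⟨0, c.cr.cc.A, 0, c.cr.cc.B, c.cr.cc.C⟩ : WeierstrassCurve ℤ)).map (Int.castRingHom ℚ)).mordellWeilRank = r := by
  haveI : Fact (Irreducible (MonicCubic.polyQ G.toS2.fs.base.a G.toS2.fs.base.b G.toS2.fs.base.c)) :=
    ⟨G.toS2.fs.base.irreducible_of_reg (G.toS2.fs.checkReg_of_coreS (G.coreS_of_check2RS h2))⟩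
  exact sha_door_map_of_door (fun h => sha_door_of_checkRSN (K := CubicField G.toS2.fs.base.a G.toS2.fs.base.b G.toS2.fs.base.c) r G
      (CubicField.aeval_root _ _ _) (CubicField.finrank_eq _ _ _) h2 hpr c hnp hc hr h) hlow

/-- **`t₂(E) = 0 ∧ rank E(ℚ) = r` for the ORIGINAL model** rescaled by `d`, in the shape of `rank_eq_of_certsRSN_scaled` plus `hr`.
[cite: CremonaAlgorithms1997, §3.6] [cite: SilvermanAEC2009, III.3.1(b), Thm. X.4.2] -/
theorem shaCorank_two_eq_zero_of_certsRSN_scaled (r : ℕ) (G : ClFieldCertRS2) (c : ClCurveCertSRN) (h2 : G.check2RS = true)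
    (hpr : G.toS2.fs.base.primeList.Forall Nat.Prime) (hnp : (c.nod.map NodalCert.ℓ).Forall Nat.Prime)
    (hc : checkRSN G c r = true) (hr : 1 ≤ r) (a₁ a₂ a₃ a₄ a₆ d : ℤ) (hd : d ≠ 0)
    (hABC : c.cr.cc.A = d ^ 2 * (a₁ ^ 2 + 4 * a₂) ∧ c.cr.cc.B = d ^ 4 * (8 * (a₁ * a₃ + 2 * a₄)) ∧
      c.cr.cc.C = d ^ 6 * (16 * (a₃ ^ 2 + 4 * a₆)))
    (hlow : r ≤ (((⟨a₁, a₂, a₃, a₄, a₆⟩ : WeierstrassCurve ℤ)).map (Int.castRingHom ℚ)).mordellWeilRank) :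
    (((⟨a₁, a₂, a₃, a₄, a₆⟩ : WeierstrassCurve ℤ)).map (Int.castRingHom ℚ)).shaCorank 2 = 0 ∧
      (((⟨a₁, a₂, a₃, a₄, a₆⟩ : WeierstrassCurve ℤ)).map (Int.castRingHom ℚ)).mordellWeilRank = r := by
  haveI : Fact (Irreducible (MonicCubic.polyQ G.toS2.fs.base.a G.toS2.fs.base.b G.toS2.fs.base.c)) :=
    ⟨G.toS2.fs.base.irreducible_of_reg (G.toS2.fs.checkReg_of_coreS (G.coreS_of_check2RS h2))⟩
  exact shaCorank_two_transport_scaled a₁ a₂ a₃ a₄ a₆ d hd hABC (deltaShort_ne_of_checkRSN hc)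
    (fun h => sha_door_of_checkRSN (K := CubicField G.toS2.fs.base.a G.toS2.fs.base.b G.toS2.fs.base.c) r G
      (CubicField.aeval_root _ _ _) (CubicField.finrank_eq _ _ _) h2 hpr c hnp hc hr h) hlow

/-- The plain completed-square shape (`d = 1`), in the shape of `rank_eq_of_certsRSN_complSq` plus `hr`.
[cite: CremonaAlgorithms1997, §3.6] [cite: SilvermanAEC2009, Thm. X.4.2] -/
theorem shaCorank_two_eq_zero_of_certsRSN_complSq (r : ℕ) (G : ClFieldCertRS2) (c : ClCurveCertSRN) (h2 : G.check2RS = true)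
    (hpr : G.toS2.fs.base.primeList.Forall Nat.Prime) (hnp : (c.nod.map NodalCert.ℓ).Forall Nat.Prime)
    (hc : checkRSN G c r = true) (hr : 1 ≤ r) (a₁ a₂ a₃ a₄ a₆ : ℤ)
    (hABC : c.cr.cc.A = a₁ ^ 2 + 4 * a₂ ∧ c.cr.cc.B = 8 * (a₁ * a₃ + 2 * a₄) ∧ c.cr.cc.C = 16 * (a₃ ^ 2 + 4 * a₆))
    (hlow : r ≤ (((⟨a₁, a₂, a₃, a₄, a₆⟩ : WeierstrassCurve ℤ)).map (Int.castRingHom ℚ)).mordellWeilRank) :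
    (((⟨a₁, a₂, a₃, a₄, a₆⟩ : WeierstrassCurve ℤ)).map (Int.castRingHom ℚ)).shaCorank 2 = 0 ∧
      (((⟨a₁, a₂, a₃, a₄, a₆⟩ : WeierstrassCurve ℤ)).map (Int.castRingHom ℚ)).mordellWeilRank = r := by
  haveI : Fact (Irreducible (MonicCubic.polyQ G.toS2.fs.base.a G.toS2.fs.base.b G.toS2.fs.base.c)) :=
    ⟨G.toS2.fs.base.irreducible_of_reg (G.toS2.fs.checkReg_of_coreS (G.coreS_of_check2RS h2))⟩
  exact shaCorank_two_transport_complSq a₁ a₂ a₃ a₄ a₆ hABC (deltaShort_ne_of_checkRSN hc)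
    (fun h => sha_door_of_checkRSN (K := CubicField G.toS2.fs.base.a G.toS2.fs.base.b G.toS2.fs.base.c) r G
      (CubicField.aeval_root _ _ _) (CubicField.finrank_eq _ _ _) h2 hpr c hnp hc hr h) hlow

/-- Door plumbing for a plain model `y² = x³ + a₂x² + a₄x + a₆`, in the shape of `rank_eq_of_certsRSN_plain` plus `hr`.
[cite: Cassels1991LecturesEllipticCurves, §15] -/
theorem sha_door_of_certsRSN_plain (r : ℕ) (G : ClFieldCertRS2) (c : ClCurveCertSRN) (h2 : G.check2RS = true)
    (hpr : G.toS2.fs.base.primeList.Forall Nat.Prime) (hnp : (c.nod.map NodalCert.ℓ).Forall Nat.Prime)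
    (hc : checkRSN G c r = true) (hr : 1 ≤ r) (a₂ a₄ a₆ : ℤ) (hABC : c.cr.cc.A = a₂ ∧ c.cr.cc.B = a₄ ∧ c.cr.cc.C = a₆)
    (hlow : r ≤ (((⟨0, a₂, 0, a₄, a₆⟩ : WeierstrassCurve ℤ)).map (Int.castRingHom ℚ)).mordellWeilRank) :
    (((⟨0, a₂, 0, a₄, a₆⟩ : WeierstrassCurve ℤ)).map (Int.castRingHom ℚ)).shaCorank 2 = 0 ∧
      AddCommGroup.primaryComponent ((((⟨0, a₂, 0, a₄, a₆⟩ : WeierstrassCurve ℤ)).map (Int.castRingHom ℚ))).sha 2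
          = ⊥ ∧
        (((⟨0, a₂, 0, a₄, a₆⟩ : WeierstrassCurve ℤ)).map (Int.castRingHom ℚ)).mordellWeilRank = r := by
  haveI : Fact (Irreducible (MonicCubic.polyQ G.toS2.fs.base.a G.toS2.fs.base.b G.toS2.fs.base.c)) :=
    ⟨G.toS2.fs.base.irreducible_of_reg (G.toS2.fs.checkReg_of_coreS (G.coreS_of_check2RS h2))⟩
  exact sha_door_transport_plain a₂ a₄ a₆ hABC
    (fun h => sha_door_of_checkRSN (K := CubicField G.toS2.fs.base.a G.toS2.fs.base.b G.toS2.fs.base.c) r G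
      (CubicField.aeval_root _ _ _) (CubicField.finrank_eq _ _ _) h2 hpr c hnp hc hr h) hlow

end Rows

end Summit.BirchSwinnertonDyer.BirchSwinnertonDyer.Theorems.ShaPrimaryTransferSelmerCubicCover

end
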